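import Summits.Parity.BatemanHorn.Theorems.RoughValueTransportBalancedSemiprimeLayerDegreeLeTwo
import Summits.Parity.BatemanHorn.Theorems.RoughValueTransportBalancedSemiprimeLayerRoughWindowLever
import Summits.Parity.BatemanHorn.Theorems.RoughValueTransportBalancedSemiprimeLayerRoughWindowTypeIDegOne
import HarnessLib

/-!
# Line `rough-relaxed-divisor-sieve` — skeleton r3 (COMPANION lead c1, prover-line-stmt-Parity-9469-c1-0)
# for the crux `BalancedSemiprimeLayer` (item stmt-Parity-9469, route `RoughValueTransport`)

Crux (by name, concluded by `BalancedSemiprimeLayer_of` below):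
`Summit.Parity.BatemanHorn.Theses.RoughValueTransport.BalancedSemiprimeLayer`.

## State (r3, 2026-08-16T20:10Z): the LEVER is a tree theorem; ONE working stub is left, and it is pure Type-I

* LANDED this seat: vocabulary (`Theorems/RoughValueTransportDefs.lean` append, p97585: `divWindow`,
  `roughDivWindow`, `posRange`, `windowPairCount`, `windowPairRem`, `RoughWindowTypeI`); anchors A
  `stub_rhoPrimeWindowSum` (p98740), B `stub_roughWindowRhoSum` (p102251), C `stub_coordLayer_le_sifted`
  (p103581), D `stub_densityProduct_le` (p99283), E `stub_sifted_le` (p104339); THE LEVER S1'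
  `stub_roughWindowLever : IsBatemanHornSystem f → RoughWindowTypeI f i → CoordLayerThin f i` for EVERY
  coordinate of EVERY Bateman–Horn system (p107548, `Theorems/…RoughWindowLever.lean`); sanity anchor
  `stub_roughWindowTypeI_degOne` (p107054: the Type-I hypothesis HOLDS in degree 1).
* OPEN (registered): S7 `stub_roughWindowTypeI_highDegree` — `RoughWindowTypeI f i` for coordinates of degree
  `≥ 3`: level `x^c` for the pair counts `#{n ∈ posRange f x : m ∣ fᵢ(n), e ∣ ∏ fⱼ(n)}` against the CRT main term
  `x·ρᵢ(m)/m·ρ_F(e)/e`, summed over the rough squarefree moduli `m ∈ [x^{dᵢ(1−δ)/2}, x^{dᵢ(1+δ)/2}]` INSIDE the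
  absolute value and over squarefree `e ≤ x^c`, error `x^{1−η}`.  No sieve, no primality: root equidistribution of
  `fᵢ mod m` in the initial segment `[1, x] ⊊ [1, m]` with power saving (moduli `≥ x^{9/8} > x`), in print only with
  log-savings (Hooley 1964).  Numerics (job j016969, X³+2): main term right to 1–3%, remainders `≤ x^{0.68}`.
  THIS is what the crux is now closed modulo (`BalancedSemiprimeLayer_of`), and what the planner can file verbatim.
* KEPT verbatim and registered: S6 `stub_coordLayerThin_highDegree` (r1 of seats -2 and -3 = the crux's degree-≥-3
  residue in unfolded route vocabulary, crux-EQUIVALENT by p78616/p75295); in r3 it is moreover a THEOREM of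
  S7 alone (`coordLayerThin_highDegree_of_typeI`, through the landed lever).

Disproof.lean (gen 2 rev 6) read: `-- Targets` concern S6 only (survives: open problem); the load-bearing
hypotheses are honoured by the lever (`pairwise_not_associated` through the sieve dimension of `F`,
`hasNoFixedPrimeDivisor` through `ρ_F(p) < p`, irreducibility through `ρᵢ(p) ≤ dᵢ`); no refuted strengthening is
instantiated (tolerance `x/(log x)^k`, order `∀ε∃δ`, joint roughness kept).
-/

noncomputable section

open Polynomial Filter Finset
open Literature.NumberTheory.Sieve
open scoped BigOperators

namespace Summit.Parity.BatemanHorn.Cruxes.BalancedSemiprimeLayer.RoughRelaxedDivisorSieve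

open Summit.Parity.BatemanHorn.Theses.RoughValueTransport (BalancedSemiprimeLayer)
open Summit.Parity.BatemanHorn.Cruxes.BalancedSemiprimeLayer.SmoothModulusTwistedHooley
  (coordLayer CoordLayerThin stub_transfer)

/-! ### Registered stubs (`sorry` lives ONLY in `stub_*`) -/

/-- **S7 `stub_roughWindowTypeI_highDegree` — THE RESIDUAL (OPEN; pure Type-I).**  For every Bateman–Horn
system and every coordinate of degree `≥ 3`, the rough balanced-divisor line has level `x^c` in the sense of
`RoughWindowTypeI` (`Theorems/RoughValueTransportDefs.lean`).  Moduli `m ≥ x^{9/8} > x`: root equidistribution of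
`fᵢ mod m` in `[1, x] ⊊ [1, m]` with power saving, on average over rough squarefree `m` of the window and twisted by
`e ∣ F(n)`, `e ≤ x^c` — not in print; this is what the crux is closed modulo.  Degree 1: PROVED
(`stub_roughWindowTypeI_degOne`, p107054); degree 2: closed by the landed line `smooth-modulus-twisted-hooley`.
Leans on: nothing available (candidate conjecture item). -/
theorem stub_roughWindowTypeI_highDegree :
    ∀ (k : ℕ) (f : Fin k → ℤ[X]), IsBatemanHornSystem f → ∀ i : Fin k,
      3 ≤ (f i).natDegree → RoughWindowTypeI f i := by
  sorry

/-- **S6 `stub_coordLayerThin_highDegree`** — r1's stub VERBATIM (seats -2 and -3; kept registered): the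
crux's degree-`≥ 3` residue in unfolded route vocabulary (= RHS of
`Split.balancedSemiprimeLayer_iff_higherLayer_unfolded`, crux-EQUIVALENT).  In r3 it is ALSO a theorem of S7
alone (`coordLayerThin_highDegree_of_typeI`). -/
theorem stub_coordLayerThin_highDegree :
    ∀ (k : ℕ) (f : Fin k → Polynomial ℤ), Literature.NumberTheory.Sieve.IsBatemanHornSystem f →
      ∀ i : Fin k, 3 ≤ (f i).natDegree → ∀ ε : ℝ, 0 < ε → ∃ δ : ℝ, 0 < δ ∧ δ ≤ 1 / 4 ∧
        ∀ᶠ x : ℕ in Filter.atTop,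
          (((Finset.Icc 1 x).filter (fun n : ℕ => (∀ j, 0 < (f j).eval (n : ℤ) ∧
              ∀ p ∈ Finset.range ⌈(x : ℝ) ^ (((f j).natDegree : ℝ) * (1 - δ) / 2)⌉₊,
                p.Prime → ¬ ((p : ℤ) ∣ (f j).eval (n : ℤ))) ∧
              ¬ ((f i).eval (n : ℤ)).toNat.Prime)).card : ℝ) ≤ ε * (x : ℝ) / Real.log x ^ k := by
  sorry

/-! ### Composition (sorry-free apart from the stubs it names) -/

/-- r1's stub from the NEW residual alone, through the LANDED lever (definitional unfolding of
`CoordLayerThin`, `coordLayer`). -/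
theorem coordLayerThin_highDegree_of_typeI
    (hT : ∀ (k : ℕ) (f : Fin k → ℤ[X]), IsBatemanHornSystem f → ∀ i : Fin k,
      3 ≤ (f i).natDegree → RoughWindowTypeI f i) :
    ∀ (k : ℕ) (f : Fin k → Polynomial ℤ), Literature.NumberTheory.Sieve.IsBatemanHornSystem f →
      ∀ i : Fin k, 3 ≤ (f i).natDegree → ∀ ε : ℝ, 0 < ε → ∃ δ : ℝ, 0 < δ ∧ δ ≤ 1 / 4 ∧
        ∀ᶠ x : ℕ in Filter.atTop,
          (((Finset.Icc 1 x).filter (fun n : ℕ => (∀ j, 0 < (f j).eval (n : ℤ) ∧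
              ∀ p ∈ Finset.range ⌈(x : ℝ) ^ (((f j).natDegree : ℝ) * (1 - δ) / 2)⌉₊,
                p.Prime → ¬ ((p : ℤ) ∣ (f j).eval (n : ℤ))) ∧
              ¬ ((f i).eval (n : ℤ)).toNat.Prime)).card : ℝ) ≤ ε * (x : ℝ) / Real.log x ^ k :=
  fun k f hf i hi => stub_roughWindowLever k f hf i (hT k f hf i hi)

/-- **THE COMPOSITION (r3).**  `BalancedSemiprimeLayer` BY NAME from the single working stub S7 through the
LANDED lever `stub_roughWindowLever` (p107548) and the LANDED transfer `stub_transfer` (p78616: glue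
`Φ_f ≤ P_f + Σᵢ Eᵢ`, `ε/k`, least `δ`, `k = 0` slice, degree `≤ 2` by the landed stubs of line
`smooth-modulus-twisted-hooley`).  `sorryAx` enters exactly through `stub_roughWindowTypeI_highDegree`. -/
theorem BalancedSemiprimeLayer_of : BalancedSemiprimeLayer :=
  stub_transfer fun k f hf i hi =>
    stub_roughWindowLever k f hf i (stub_roughWindowTypeI_highDegree k f hf i hi)

/-- **r1's composition, kept** (seats -2 and -3): the crux BY NAME from S6 alone. -/
theorem BalancedSemiprimeLayer_of' : BalancedSemiprimeLayer :=
  stub_transfer stub_coordLayerThin_highDegree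

/-- The linear layer through THIS line, unconditionally (LANDED lever + LANDED degree-1 Type-I, p107054): a
second, independent tree proof of the degree-1 case of `Split.coordLayerThin_of_natDegree_le_two`. -/
theorem coordLayerThin_of_natDegree_eq_one {k : ℕ} {f : Fin k → ℤ[X]} (hf : IsBatemanHornSystem f)
    (i : Fin k) (h1 : (f i).natDegree = 1) : CoordLayerThin f i :=
  stub_roughWindowLever k f hf i (stub_roughWindowTypeI_degOne k f hf i h1)

end Summit.Parity.BatemanHorn.Cruxes.BalancedSemiprimeLayer.RoughRelaxedDivisorSieve
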